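import Summits.Langlands.Langlands.Theorems.AbelianSurfaceSerreSurfaceSectorComplementRigidityTransportLAlg
import Summits.Langlands.Langlands.Theorems.IrreducibilityBySelfDualityReciprocityUpToIrreducibilityRTightness
import Summits.Langlands.Langlands.Theses.AbelianSurfaceSerre
import HarnessLib

/-!
# The rigidity seam S1ʷ is implied by the summit — unconditionally
(crux `AbelianSurfaceSerre.SurfaceSectorComplement`, stmt-Langlands-17767, line `Sketch`, continuation
lead c4; `--supports` file; no definitions; standard axioms)

Line `Sketch` closes the frame item `SurfaceSectorComplement := EndTrivialSurfacesModular → Langlands`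
from four registered stubs: S1ʷ `stub_recRigidityLAlg` (two PINNED reciprocity data `𝓡`, `𝓡'` of a
number field `K` have the same `rec_n` on every local component of every L-ALGEBRAIC cuspidal `π` of
`GL_n(𝔸_K)`) and the junction S2a–S2c in `∃ 𝓡` form, through the landed glue
`langlands_iff_exists_of_rigid_lAlgebraic : S1ʷ → (Langlands ↔ Langlands_∃)`.  The stubs S2a–S2c are
implied by the summit outright (`Theorems/SurfaceSectorComplement/Negative/…StubsVersusSummit.lean`).
For S1ʷ this was asserted only in prose ("modulo Chebotarev + Brauer–Nesbitt"), and it is not obvious: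
the tree's `IsLocalLanglandsGL` deliberately does NOT pin `rec_n` on all classes
(`Literature/NumberTheory/Automorphic/LocalLanglandsGL.lean`, "Uniqueness"), so a rigidity statement
quantified over ALL pinned data could a priori over-claim relative to the `∀ 𝓡` summit.

This file proves, sorry-free and from PROVED tree theorems only (Chebotarev and Brauer–Nesbitt are
theorems of the tree: `chebotarev_artinRep_holds`, `brauerNesbitt_holds`, consumed through the landed
`ReciprocityUpToIrreducibility.isConjugate_of_satakeFrobCompatibleAt` / `corresponds_of_isConjugate`;
independence of the Grothendieck–Deligne recipe, uniqueness of local components and of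
Frobenius-semisimplification, through the landed
`ReciprocityUpToIrreducibilityR.recGL_eq_of_localGlobalCompatibleAtR`; `ℚ̄_ℓ ≃ ℂ` exists,
`PadicAlgCl.nonempty_ringEquiv_complex`).  The import closure is kept free of every OTHER route's
`Theses` module (stale-olean hazard, INFRA evidence on this item 2026-08-17; same design as
`…ReciprocityUpToIrreducibilityRTightness.lean`).  Contents:

* `recGL_eq_of_automorphicToGalois` — **direction (A) at level `hcpt` for `𝓡` AND for `𝓡'` already
  forces `rec_{𝓡,v}(π_v) = rec_{𝓡',v}(π_v)`** on every local component of every L-algebraic cuspidal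
  `π` of that level: read both data at `v` through a prime `ℓ ∤ v`; the two irreducible `ℓ`-adic
  avatars of `π` are conjugate (Chebotarev + Brauer–Nesbitt), `Corresponds` descends to conjugacy
  classes, and two data locally–globally compatible with ONE pair `(π, ρ)` at `v ∤ ℓ` agree on `π_v`;
* `galoisToAutomorphic_iff_of_automorphicToGalois`, `globalLanglands_iff_of_automorphicToGalois` —
  hence, between two data that both satisfy (A), direction (B) and the whole correspondence transport;
* `recRigidityLAlg_of_langlands : Langlands → S1ʷ` (S1ʷ verbatim = the registered stub's text) and
  `langlands_iff_recRigidityLAlg_and_exists : Langlands ↔ S1ʷ ∧ Langlands_∃` — the `∃ 𝓡 ↦ ∀ 𝓡`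
  re-type of the summit (2026-08-16) adds to the `∃` form EXACTLY S1ʷ, no more;
* `langlands_iff_exists_and_forall_automorphicToGalois : Langlands ↔ Langlands_∃ ∧ (∀ F 𝓡 n > 0
  hcpt, (A))` — equivalently, exactly "direction (A) for every pinned datum";
* `surfaceSectorComplement_iff_rigidity_and_junction : C ↔ (X → S1ʷ) ∧ (X → Langlands_∃)` — the
  line's decomposition is TIGHT: nothing is lost except that the skeleton states S1ʷ outside the
  (idle) hypothesis `X`.

Consequences recorded for the planners (no new obligations): (1) S1ʷ is NOT an over-claim — it sits
between Henniart-type uniqueness of `rec_v` on generic classes (which implies it) and the summit (which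
implies it); (2) the UNRESTRICTED rigidity R of the twin line `Sketch_18745_r1_k1` (all cuspidal `π`,
consumed by `langlands_iff_exists_of_rigid`) and the generic-class rigidity U `PinnedRecRigidity` of the
`PhantomRMJunction` split are NOT obtained this way (the summit is silent off L-algebraic `π`), so
S1ʷ is the tight form of the rigidity seam shared by every `∀ 𝓡` frame item.

References: P. Deligne, J.-P. Serre, ASENS 7 (1974), Lemme 3.2 [DeligneSerreASENS1974]; P. Deligne,
Antwerp II, LNM 349 (1973), §8.4 [DeligneAntwerpII1973]; K. Buzzard, T. Gee, LMS LNS 414 (2014),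
Conj. 3.2.1–3.2.2 [BuzzardGeeLMS2014]; G. Henniart, Invent. Math. 113 (1993), Thm. 1.1 [Henniarts1993].
-/

noncomputable section

set_option linter.dupNamespace false -- project-wide option; `Summit.Langlands.Langlands` is the mandated namespace

open scoped MatrixGroups NumberField
open NumberField IsDedekindDomain Filter
open Literature.NumberTheory.Automorphic Literature.NumberTheory.GaloisRepresentations
open Summit.Langlands
open Summit.Langlands.Langlands.Theses.AbelianSurfaceSerre

namespace Summit.Langlands.Langlands.Theorems.ReciprocityRigidity

/-! ## 1. Direction (A) for two pinned data forces rigidity on L-algebraic local components -/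

section Local

variable {K : Type} [Field K] [NumberField K] {n : ℕ} {hcpt : isCompact_glFiniteIntegralLevel n K}

/-- **Direction (A) for two pinned reciprocity data forces them to agree on the local components of
the L-algebraic cuspidal `π` of that level.**  Read both data at `v` through a prime `ℓ ∤ v` (`2` or
`3`) and an `ι : ℚ̄_ℓ ≃ ℂ`: the avatars `ρ` (for `𝓡`) and `ρ'` (for `𝓡'`) of `π` are both
Satake–Frobenius compatible with `π` a.e. and `ρ` is irreducible, so they are conjugate (Chebotarev +
Brauer–Nesbitt, tree theorems) and `ρ'` corresponds to `π` for `𝓡` as well; the two local–global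
compatibility clauses at `v` for the one pair `(π, ρ')` attach to `ρ'|_{W_v}` isomorphic Weil–Deligne
representations (independence of the Grothendieck–Deligne recipe), whose complex transports name one
Frobenius-semisimple class, read on one class of local components (unique up to isomorphism).
[cite: DeligneSerreASENS1974, Lemme 3.2] [cite: DeligneAntwerpII1973, §8.4] -/
theorem recGL_eq_of_automorphicToGalois (𝓡 𝓡' : ReciprocityData K)
    (hA : AutomorphicToGalois n 𝓡 hcpt) (hA' : AutomorphicToGalois n 𝓡' hcpt)
    (π : CuspidalAutomorphicRepData n K hcpt) (hπ : π.1.IsLAlgebraic) (v : HeightOneSpectrum (𝓞 K))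
    (πv : SmoothIrrep (GL (Fin n) (v.adicCompletion K))) (hπv : π.1.HasLocalComponentAt v πv.ρ) :
    (𝓡.llc v).recGL n (IrrClass.mk πv) = (𝓡'.llc v).recGL n (IrrClass.mk πv) := by
  -- a rational prime away from `v`
  obtain ⟨ℓ, _, hℓ⟩ : ∃ (ℓ : ℕ) (_ : Fact ℓ.Prime), ((ℓ : ℕ) : 𝓞 K) ∉ v.asIdeal := by
    by_cases h2 : ((2 : ℕ) : 𝓞 K) ∈ v.asIdeal
    · refine ⟨3, ⟨Nat.prime_three⟩, fun h3 => v.isPrime.ne_top ((Ideal.eq_top_iff_one _).2 ?_)⟩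
      have h := v.asIdeal.sub_mem h3 h2
      have h1 : ((3 : ℕ) : 𝓞 K) - ((2 : ℕ) : 𝓞 K) = 1 := by push_cast; norm_num
      rwa [h1] at h
    · exact ⟨2, ⟨Nat.prime_two⟩, h2⟩
  obtain ⟨ι⟩ := PadicAlgCl.nonempty_ringEquiv_complex ℓ
  -- the two avatars of `π`, conjugate; `ρ'` corresponds to `π` for BOTH data
  obtain ⟨ρ, hirr, -, hcorr, -⟩ := hA π hπ ℓ ι
  obtain ⟨ρ', -, -, hcorr', -⟩ := hA' π hπ ℓ ι
  have hc : Corresponds 𝓡 ι π.1 ρ' :=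
    ReciprocityUpToIrreducibility.corresponds_of_isConjugate hcorr
      (ReciprocityUpToIrreducibility.isConjugate_of_satakeFrobCompatibleAt π.1 ι hirr hcorr.1 hcorr'.1)
  -- read both data at `v` through the pair `(π, ρ')`
  exact ReciprocityUpToIrreducibilityR.recGL_eq_of_localGlobalCompatibleAtR 𝓡 𝓡' ι π ρ' hℓ (hc.2 v)
    (hcorr'.2 v) πv hπv

/-- **Between two data that both satisfy direction (A), direction (B) transports** (along the
rigidity of `recGL_eq_of_automorphicToGalois`, by the landed
`galoisToAutomorphic_transport_of_isLAlgebraic`). [cite: BuzzardGeeLMS2014, Conj. 3.2.2] -/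
theorem galoisToAutomorphic_iff_of_automorphicToGalois (𝓡 𝓡' : ReciprocityData K)
    (hA : AutomorphicToGalois n 𝓡 hcpt) (hA' : AutomorphicToGalois n 𝓡' hcpt) :
    GaloisToAutomorphic n 𝓡 hcpt ↔ GaloisToAutomorphic n 𝓡' hcpt :=
  ⟨galoisToAutomorphic_transport_of_isLAlgebraic 𝓡 𝓡' (recGL_eq_of_automorphicToGalois 𝓡 𝓡' hA hA'),
    galoisToAutomorphic_transport_of_isLAlgebraic 𝓡' 𝓡 (recGL_eq_of_automorphicToGalois 𝓡' 𝓡 hA' hA)⟩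

/-- **Between two data that both satisfy direction (A), the whole rank-`n` correspondence
transports.** [cite: BuzzardGeeLMS2014, Conj. 3.2.2] -/
theorem globalLanglands_iff_of_automorphicToGalois (𝓡 𝓡' : ReciprocityData K)
    (hA : AutomorphicToGalois n 𝓡 hcpt) (hA' : AutomorphicToGalois n 𝓡' hcpt) :
    GlobalLanglandsCorrespondenceGLn n K 𝓡 hcpt ↔ GlobalLanglandsCorrespondenceGLn n K 𝓡' hcpt :=
  ⟨fun h ↦ ⟨hA', (galoisToAutomorphic_iff_of_automorphicToGalois 𝓡 𝓡' hA hA').1 h.2⟩,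
    fun h ↦ ⟨hA, (galoisToAutomorphic_iff_of_automorphicToGalois 𝓡 𝓡' hA hA').2 h.2⟩⟩

/-- **Two data for which the rank-`n` correspondence holds agree on the local components of the
L-algebraic cuspidal `π` of that level.** [cite: DeligneSerreASENS1974, Lemme 3.2] -/
theorem recGL_eq_of_globalLanglands (𝓡 𝓡' : ReciprocityData K)
    (h : GlobalLanglandsCorrespondenceGLn n K 𝓡 hcpt) (h' : GlobalLanglandsCorrespondenceGLn n K 𝓡' hcpt)
    (π : CuspidalAutomorphicRepData n K hcpt) (hπ : π.1.IsLAlgebraic) (v : HeightOneSpectrum (𝓞 K))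
    (πv : SmoothIrrep (GL (Fin n) (v.adicCompletion K))) (hπv : π.1.HasLocalComponentAt v πv.ρ) :
    (𝓡.llc v).recGL n (IrrClass.mk πv) = (𝓡'.llc v).recGL n (IrrClass.mk πv) :=
  recGL_eq_of_automorphicToGalois 𝓡 𝓡' h.1 h'.1 π hπ v πv hπv

end Local

/-- **The summit implies the rigidity stub S1ʷ of line `Sketch`** (text VERBATIM the registered stub
`stub_recRigidityLAlg` of crux stmt-Langlands-17767): granted `Langlands` (for ALL pinned data), any two
pinned reciprocity data of `K` have the same `rec_n` on every local component of every L-algebraic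
cuspidal `π` of `GL_n(𝔸_K)`, `n ≥ 1` — because direction (A) holds for both.  Unconditional (no named
fact): Chebotarev and Brauer–Nesbitt are theorems of the tree. [cite: DeligneSerreASENS1974, Lemme 3.2] -/
theorem recRigidityLAlg_of_langlands : _root_.Langlands →
    ∀ (K : Type) [Field K] [NumberField K] (𝓡 𝓡' : ReciprocityData K) (n : ℕ)
      (hcpt : isCompact_glFiniteIntegralLevel n K), 0 < n →
      ∀ π : CuspidalAutomorphicRepData n K hcpt, π.1.IsLAlgebraic →
        ∀ (v : HeightOneSpectrum (𝓞 K)) (πv : SmoothIrrep (GL (Fin n) (v.adicCompletion K))),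
          π.1.HasLocalComponentAt v πv.ρ →
            (𝓡.llc v).recGL n (IrrClass.mk πv) = (𝓡'.llc v).recGL n (IrrClass.mk πv) := by
  intro hL K _ _ 𝓡 𝓡' n hcpt hn π hπ v πv hπv
  obtain ⟨-, hall⟩ := hL K
  obtain ⟨hA, -⟩ := hall 𝓡 n hn hcpt
  obtain ⟨hA', -⟩ := hall 𝓡' n hn hcpt
  exact recGL_eq_of_automorphicToGalois 𝓡 𝓡' hA hA' π hπ v πv hπv

/-- **`Langlands ↔ S1ʷ ∧ Langlands_∃`**: the `∃ 𝓡 ↦ ∀ 𝓡` re-type of the summit (2026-08-16) adds to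
the `∃`-form exactly the rigidity S1ʷ on local components of L-algebraic cuspidal `π` — necessary by
`recRigidityLAlg_of_langlands`, sufficient by the landed `langlands_iff_exists_of_rigid_lAlgebraic`.
[cite: BuzzardGeeLMS2014, Conj. 3.2.1 and Conj. 3.2.2] -/
theorem langlands_iff_recRigidityLAlg_and_exists :
    _root_.Langlands ↔
      (∀ (K : Type) [Field K] [NumberField K] (𝓡 𝓡' : ReciprocityData K) (n : ℕ)
        (hcpt : isCompact_glFiniteIntegralLevel n K), 0 < n →
        ∀ π : CuspidalAutomorphicRepData n K hcpt, π.1.IsLAlgebraic →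
          ∀ (v : HeightOneSpectrum (𝓞 K)) (πv : SmoothIrrep (GL (Fin n) (v.adicCompletion K))),
            π.1.HasLocalComponentAt v πv.ρ →
              (𝓡.llc v).recGL n (IrrClass.mk πv) = (𝓡'.llc v).recGL n (IrrClass.mk πv)) ∧
      ∀ (F : Type) [Field F] [NumberField F], ∃ 𝓡 : ReciprocityData F, ∀ n : ℕ, 0 < n →
        ∀ hcpt : isCompact_glFiniteIntegralLevel n F, GlobalLanglandsCorrespondenceGLn n F 𝓡 hcpt :=
  ⟨fun hL ↦ ⟨recRigidityLAlg_of_langlands hL,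
      (langlands_iff_exists_of_rigid_lAlgebraic (recRigidityLAlg_of_langlands hL)).1 hL⟩,
    fun h ↦ (langlands_iff_exists_of_rigid_lAlgebraic h.1).2 h.2⟩

/-- **`Langlands ↔ Langlands_∃ ∧ (direction (A) for every pinned datum)`**: given the `∃`-form,
direction (A) for an arbitrary pinned datum `𝓡` is all that the `∀ 𝓡` summit further asks — direction
(B) for `𝓡` is then transported from the witness datum (`galoisToAutomorphic_iff_of_automorphicToGalois`).
[cite: BuzzardGeeLMS2014, Conj. 3.2.1 and Conj. 3.2.2] [cite: FontaineMazurGeometric1995, Conj. 1] -/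
theorem langlands_iff_exists_and_forall_automorphicToGalois :
    _root_.Langlands ↔
      (∀ (F : Type) [Field F] [NumberField F], ∃ 𝓡 : ReciprocityData F, ∀ n : ℕ, 0 < n →
        ∀ hcpt : isCompact_glFiniteIntegralLevel n F, GlobalLanglandsCorrespondenceGLn n F 𝓡 hcpt) ∧
      ∀ (F : Type) [Field F] [NumberField F] (𝓡 : ReciprocityData F) (n : ℕ), 0 < n →
        ∀ hcpt : isCompact_glFiniteIntegralLevel n F, AutomorphicToGalois n 𝓡 hcpt := by
  refine ⟨fun hL ↦ ⟨fun F _ _ ↦ ?_, fun F _ _ 𝓡 n hn hcpt ↦ ((hL F).2 𝓡 n hn hcpt).1⟩,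
    fun h F _ _ ↦ ?_⟩
  · obtain ⟨⟨𝓡⟩, hall⟩ := hL F
    exact ⟨𝓡, hall 𝓡⟩
  · obtain ⟨hE, hA⟩ := h
    obtain ⟨𝓡₀, h₀⟩ := hE F
    refine ⟨⟨𝓡₀⟩, fun 𝓡 n hn hcpt ↦ ?_⟩
    exact (globalLanglands_iff_of_automorphicToGalois 𝓡₀ 𝓡 (h₀ n hn hcpt).1 (hA F 𝓡 n hn hcpt)).1
      (h₀ n hn hcpt)

/-- **Tightness of line `Sketch` at the crux**: `SurfaceSectorComplement ↔ (X → S1ʷ) ∧ (X → Langlands_∃)`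
(`X = EndTrivialSurfacesModular`; S1ʷ and the junction `Langlands_∃` spelled out).  The skeleton
`Lines/Sketch.lean` composes the crux from S1ʷ (stated outside the idle hypothesis `X`) and the junction
S2a ∘ S2b ∘ S2c; conversely the crux returns both under `X`.  So the line's stub set is equivalent to the
crux modulo moving S1ʷ out from under `X`, and every stub is implied by the summit.
[cite: BuzzardGeeLMS2014, Conj. 3.2.1 and Conj. 3.2.2] -/
theorem surfaceSectorComplement_iff_rigidity_and_junction :
    SurfaceSectorComplement ↔
      (EndTrivialSurfacesModular →
        ∀ (K : Type) [Field K] [NumberField K] (𝓡 𝓡' : ReciprocityData K) (n : ℕ)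
          (hcpt : isCompact_glFiniteIntegralLevel n K), 0 < n →
          ∀ π : CuspidalAutomorphicRepData n K hcpt, π.1.IsLAlgebraic →
            ∀ (v : HeightOneSpectrum (𝓞 K)) (πv : SmoothIrrep (GL (Fin n) (v.adicCompletion K))),
              π.1.HasLocalComponentAt v πv.ρ →
                (𝓡.llc v).recGL n (IrrClass.mk πv) = (𝓡'.llc v).recGL n (IrrClass.mk πv)) ∧
      (EndTrivialSurfacesModular →
        ∀ (F : Type) [Field F] [NumberField F], ∃ 𝓡 : ReciprocityData F, ∀ n : ℕ, 0 < n →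
          ∀ hcpt : isCompact_glFiniteIntegralLevel n F, GlobalLanglandsCorrespondenceGLn n F 𝓡 hcpt) :=
  ⟨fun hC ↦ ⟨fun hX ↦ recRigidityLAlg_of_langlands (hC hX),
      fun hX ↦ (langlands_iff_recRigidityLAlg_and_exists.1 (hC hX)).2⟩,
    fun h hX ↦ (langlands_iff_exists_of_rigid_lAlgebraic (h.1 hX)).2 (h.2 hX)⟩

end Summit.Langlands.Langlands.Theorems.ReciprocityRigidity

end
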